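import Summits.BirchSwinnertonDyer.BirchSwinnertonDyer.Theorems.OneSidedTwistSqueezeX9KatoDivisibilityX9LocalPCarrierPk
import Summits.BirchSwinnertonDyer.Rank1Residual.X11b.LocalTrivialityBridge
import Literature.NumberTheory.EllipticCurves.IwasawaTwistModPkTower
import Literature.NumberTheory.EllipticCurves.GreenbergSelmer
import Literature.NumberTheory.EllipticCurves.IwasawaTwistModPDual
import Mathlib.NumberTheory.Padics.RingHoms
import HarnessLib

/-!
# Line `graded_euler_loss` of crux `KatoDivisibilityX9` (stmt-BirchSwinnertonDyer-20547), stub 1a' `stub_testCocyclePkLevelX9`,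
# the local clause AT `p` — level-`p^k` engine, file 2 of 2: a class of `H¹(K, 𝒯^{(k)}_L)` whose cocycle is PRINCIPAL on
# `D_v ∩ Γ_∞` dies at `v` after `T^b`, `p^b ≥ #M^{D_v ∩ Γ_∞}`, uniformly in `L` (no Shapiro, no corestriction)

Seat `bsd-line-k6-p4` (prover-bsd-line-k6-p4-g5-0, 5th LEAD on the crux).  THEOREMS ONLY — no definition, no named fact, no
`sorry`; credits nothing (`--supports … --as helper`).  Sequel of `…KatoDivisibilityX9LocalPCarrierPk` (§1 there:
`S^b A ⊆ (d₀ − 1)A` on the `D ∩ Γ_∞`-fixed vectors).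
* §2 `localization_shiftH1Pk_iterate_eq_zero_of_principal_on_decomp_inf_ker` — for a cocycle `Φ` of `𝒯^{(k)}_L = κ.twistModPk ρ hM L`
  principal on `decomp v ⊓ ker κ`, with `d₀ ∈ decomp v` a topological generator of `κ`: `loc_v (T^[b] [Φ]) = 0`.  Proof: make `Φ`
  vanish on `D_∞ := decomp v ⊓ ker κ`; then `Φ(d₀)` is `D_∞`-fixed and file 1 gives `S^bΦ(d₀) = d₀a′ − a′`, `a′` `D_∞`-fixed; the
  `l ∈ Γ_{K_v}` with `S^bΦ(res l) = res l·a′ − a′` form a CLOSED SUBGROUP containing a lift of `d₀` and `res⁻¹(ker κ)`, whose image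
  under `κ ∘ res` is compact and contains `ℤ` (dense in `ℤ_p`, `PadicInt.denseRange_intCast`) — so it is all of `Γ_{K_v}`; conclude
  by x11b's `LocBridge.map_oneCocycleClass_eq_zero_iff`.
* §3 the elliptic spelling for `W.modPkTwist p k κ.invTwist L` (`ker κ⁻¹ = ker κ`).
NOT HERE (honest): the existence of `d₀ ∈ decomp v` (total ramification of `p` in the cyclotomic tower), the bound on
`#E(K_{∞,𝔭})[p^k]`, and the fine-Selmer input producing the principal cocycle after finitely many shifts — the 1a′ prover's.
Closes nothing; BSD is not proved by any of this; no summit statement is proved by this seat.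
References: J.-P. Serre, *Galois Cohomology* I §2.2–2.5, §5.1 [SerreGaloisCohomology1997]; J. Neukirch, A. Schmidt, K. Wingberg
(2008) (1.6.4)–(1.6.5) [NeukirchSchmidtWingberg2008]; R. Greenberg, LNM 1716 (1999) §3 [GreenbergLNM1716]; L. Washington, GTM 83
§13.1–13.2 [Washington1997].
-/

set_option linter.dupNamespace false
set_option autoImplicit false

noncomputable section

open scoped Classical ContRepresentation

universe u

namespace Summit.BirchSwinnertonDyer.BirchSwinnertonDyer.Theorems.OneSidedTwistSqueezeX9KatoDivisibilityX9LocalPEnginePk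

open Summit.BirchSwinnertonDyer.BirchSwinnertonDyer.Theorems.OneSidedTwistSqueezeX9KatoDivisibilityX9LocalPCarrierPk
open Function Field NumberField IsDedekindDomain
open Literature.NumberTheory.GaloisRepresentations
open Literature.NumberTheory.EllipticCurves

/-! ## §2 From a cocycle principal on `D_v ∩ Γ_∞` to `loc_v (T^[b] ·) = 0` -/

section Local

open Literature.NumberTheory.EllipticCurves.GreenbergSelmer (decomp)
open Summit.BirchSwinnertonDyer.Rank1Residual.X11b

variable {K : Type u} [Field K] [NumberField K] {M : Type u} [AddCommGroup M] [TopologicalSpace M]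
  [DiscreteTopology M] [Finite M] (ρ : DiscreteGaloisModule K M) {p : ℕ} [hp : Fact p.Prime] {k : ℕ}
  (hM : ∀ x : M, p ^ k • x = 0) (κ : ZpExtension K p) (L : ℕ) (v : HeightOneSpectrum (𝓞 K))

/-- **The level-`p^k` local engine at a place whose decomposition group contains a topological generator.**  Let
`D_v = decomp v ≤ Γ_K` contain `d₀` with `κ d₀ = 1 ∈ ℤ_p` (at the place above `p` of the cyclotomic tower: total
ramification), `D_∞ := D_v ⊓ ker κ`, and `p^b ≥ #{m ∈ M : D_∞ fixes m}`.  If a cocycle `Φ` of `𝒯^{(k)}_L = κ.twistModPk ρ hM L` is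
PRINCIPAL on `D_∞` (`Φ(u) = u·x − x` there), then `loc_v (T^[b] [Φ]) = 0` — for EVERY level `L`, with the SAME `b`.  (After removing
the coboundary, `Φ(d₀)` is `D_∞`-fixed; §1 writes `S^bΦ(d₀) = d₀a′ − a′`; the `l ∈ Γ_{K_v}` with `S^bΦ(res l) = res l·a′ − a′` form a
closed subgroup containing a lift of `d₀` and `res⁻¹(ker κ)`, whose image under `κ ∘ res` is compact and contains `ℤ`, dense in
`ℤ_p` — so it is all of `Γ_{K_v}`; x11b `LocBridge.map_oneCocycleClass_eq_zero_iff`.)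
[cite: SerreGaloisCohomology1997, I §2.2–2.5, §5.1] [cite: NeukirchSchmidtWingberg2008, (1.6.4)–(1.6.5)] -/
theorem localization_shiftH1Pk_iterate_eq_zero_of_principal_on_decomp_inf_ker
    {d₀ : absoluteGaloisGroup K} (hd₀D : d₀ ∈ decomp v) (hd₀ : κ.IsTopGenerator d₀) {b : ℕ}
    (hN₀ : Nat.card {m : M // ∀ u ∈ decomp v ⊓ κ.kerSubgroup, ρ u m = m} ≤ p ^ b)
    (Φ : contOneCocycles (κ.twistModPk ρ hM L).toTopRep)
    (hΦ : ∃ x : Fin L → M, ∀ u ∈ decomp v ⊓ κ.kerSubgroup, Φ.1 u = κ.twistModPk ρ hM L u x - x) :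
    galoisCohomology.localization (κ.twistModPk ρ hM L) (Sum.inr v) 1
      ((κ.shiftH1Pk ρ hM L)^[b] (oneCocycleClass _ Φ)) = 0 := by
  obtain ⟨x, hx⟩ := hΦ
  -- Step 1: remove the coboundary of `x`: `Φ₁ = Φ − ∂x` vanishes on `D_∞` and has the same class
  let ψx : contOneCocycles (κ.twistModPk ρ hM L).toTopRep :=
    ⟨⟨fun g => κ.twistModPk ρ hM L g x - x, ((κ.twistModPk ρ hM L).continuous_apply_left x).sub continuous_const⟩, fun g h => by
      change κ.twistModPk ρ hM L (g * h) x - x = (κ.twistModPk ρ hM L g x - x) + κ.twistModPk ρ hM L g (κ.twistModPk ρ hM L h x - x)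
      rw [map_mul, Module.End.mul_apply, map_sub]
      abel⟩
  have hψx : oneCocycleClass (κ.twistModPk ρ hM L).toTopRep ψx = 0 :=
    (oneCocycleClass_eq_zero_iff _ ψx).2 ⟨x, fun g => rfl⟩
  let Φ₁ : contOneCocycles (κ.twistModPk ρ hM L).toTopRep := Φ - ψx
  have hΦ₁ : ∀ u ∈ decomp v ⊓ κ.kerSubgroup, Φ₁.1 u = 0 := fun u hu => by
    change Φ.1 u - (κ.twistModPk ρ hM L u x - x) = 0
    rw [hx u hu, sub_self]
  have hclass : oneCocycleClass (κ.twistModPk ρ hM L).toTopRep Φ = oneCocycleClass (κ.twistModPk ρ hM L).toTopRep Φ₁ := by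
    rw [show Φ₁ = Φ - ψx from rfl, oneCocycleClass_sub, hψx, sub_zero]
  rw [hclass, ZpExtension.shiftH1Pk_iterate_oneCocycleClass]
  -- Step 2: `Φ₁(g)` is `D_∞`-fixed for `g ∈ D_v`
  have hconj : ∀ u ∈ decomp v ⊓ κ.kerSubgroup, ∀ g ∈ decomp v, g⁻¹ * u * g ∈ decomp v ⊓ κ.kerSubgroup :=
    fun u hu g hg => ⟨(decomp v).mul_mem ((decomp v).mul_mem ((decomp v).inv_mem hg) hu.1) hg,
      conj_mem_kerSubgroup κ hu.2 g⟩
  have hA : ∀ g ∈ decomp v, ∀ u ∈ decomp v ⊓ κ.kerSubgroup, κ.twistModPk ρ hM L u (Φ₁.1 g) = Φ₁.1 g := by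
    intro g hg u hu
    have h1 : Φ₁.1 (u * g) = Φ₁.1 u + κ.twistModPk ρ hM L u (Φ₁.1 g) := Φ₁.2 u g
    rw [hΦ₁ u hu, zero_add] at h1
    have h2 : Φ₁.1 (g * (g⁻¹ * u * g)) = Φ₁.1 g + κ.twistModPk ρ hM L g (Φ₁.1 (g⁻¹ * u * g)) := Φ₁.2 _ _
    rw [hΦ₁ _ (hconj u hu g hg), map_zero, add_zero, show g * (g⁻¹ * u * g) = u * g by group] at h2
    exact h1.symm.trans h2
  -- Step 3: §1 on `a := Φ₁(d₀)`
  obtain ⟨a', ha'A, ha'⟩ := exists_shiftEnd_pow_eq_sub_of_fixed ρ hM κ L (decomp v) hd₀D hd₀ hN₀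
    (Φ₁.1 d₀) (hA d₀ hd₀D)
  -- Step 4: the closed subgroup `Z ≤ Γ_{K_v}` on which `S^bΦ₁ ∘ res` is the coboundary of `a′`
  set F := v.adicCompletion K with hFdef
  let res := absGaloisRestrict K F
  let φ := κ.shiftPowCocyclePk ρ hM L b Φ₁
  have hφ : ∀ g, φ.1 g = (shiftEnd M L ^ b) (Φ₁.1 g) := fun g => rfl
  let Z : Subgroup (absoluteGaloisGroup F) :=
    { carrier := {l | φ.1 (res l) = κ.twistModPk ρ hM L (res l) a' - a'}
      mul_mem' := fun {l l'} hl hl' => by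
        change φ.1 (res l) = κ.twistModPk ρ hM L (res l) a' - a' at hl
        change φ.1 (res l') = κ.twistModPk ρ hM L (res l') a' - a' at hl'
        change φ.1 (res (l * l')) = κ.twistModPk ρ hM L (res (l * l')) a' - a'
        have hc : φ.1 (res l * res l') = φ.1 (res l) + κ.twistModPk ρ hM L (res l) (φ.1 (res l')) := φ.2 _ _
        rw [map_mul, hc, hl, hl', map_sub, map_mul, Module.End.mul_apply]
        abel
      one_mem' := by
        change φ.1 (res 1) = κ.twistModPk ρ hM L (res 1) a' - a'
        rw [map_one, contOneCocycles.apply_one, map_one, Module.End.one_apply, sub_self]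
      inv_mem' := fun {l} hl => by
        change φ.1 (res l) = κ.twistModPk ρ hM L (res l) a' - a' at hl
        change φ.1 (res l⁻¹) = κ.twistModPk ρ hM L (res l⁻¹) a' - a'
        have hc : φ.1 (res l⁻¹ * res l) = φ.1 (res l⁻¹) + κ.twistModPk ρ hM L (res l⁻¹) (φ.1 (res l)) := φ.2 _ _
        have h1 : φ.1 (res l⁻¹ * res l) = 0 := by
          rw [← map_mul, inv_mul_cancel, map_one, contOneCocycles.apply_one]
        have h2 : κ.twistModPk ρ hM L (res l⁻¹) (κ.twistModPk ρ hM L (res l) a') = a' := by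
          rw [← Module.End.mul_apply, ← map_mul, ← map_mul, inv_mul_cancel, map_one, map_one,
            Module.End.one_apply]
        rw [h1, hl, map_sub, h2] at hc
        have h3 : φ.1 (res l⁻¹) = -(a' - κ.twistModPk ρ hM L (res l⁻¹) a') := eq_neg_of_add_eq_zero_left hc.symm
        rw [h3, neg_sub] }
  have hmemZ : ∀ l, l ∈ Z ↔ φ.1 (res l) = κ.twistModPk ρ hM L (res l) a' - a' := fun l => Iff.rfl
  -- `Z` is closed
  have hZclosed : IsClosed (Z : Set (absoluteGaloisGroup F)) :=
    isClosed_eq (φ.1.continuous.comp (map_continuous res))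
      ((((κ.twistModPk ρ hM L).continuous_apply_left a').comp (map_continuous res)).sub continuous_const)
  -- a lift `l₀` of `d₀` lies in `Z`
  obtain ⟨l₀, hl₀⟩ := MonoidHom.mem_range.1 hd₀D
  have hl₀' : res l₀ = d₀ := hl₀
  have hl₀Z : l₀ ∈ Z := by
    rw [hmemZ, hl₀', hφ, ha']
  -- `res⁻¹(ker κ) ≤ Z`
  have hZker : ∀ l, res l ∈ κ.kerSubgroup → l ∈ Z := by
    intro l hl
    have hD : res l ∈ decomp v ⊓ κ.kerSubgroup := ⟨⟨l, rfl⟩, hl⟩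
    rw [hmemZ, hφ, hΦ₁ _ hD, map_zero, ha'A _ hD, sub_self]
  -- `Z = Γ_{K_v}`: its image under `κ ∘ res` is compact and contains the dense subset `ℤ ⊂ ℤ_p`
  have hZtop : ∀ l, l ∈ Z := by
    intro l
    haveI : CompactSpace (absoluteGaloisGroup F) := absoluteGaloisGroup_compactSpace F
    let f : absoluteGaloisGroup F → ℤ_[p] := fun z => Multiplicative.toAdd (κ (res z))
    have hf : Continuous f :=
      continuous_toAdd.comp ((map_continuous κ).comp (map_continuous res))
    have hC : IsClosed (f '' (Z : Set (absoluteGaloisGroup F))) :=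
      (hZclosed.isCompact.image hf).isClosed
    have hsub : Set.range (Int.cast : ℤ → ℤ_[p]) ⊆ f '' (Z : Set (absoluteGaloisGroup F)) := by
      rintro _ ⟨n, rfl⟩
      refine ⟨l₀ ^ n, Z.zpow_mem hl₀Z n, ?_⟩
      change Multiplicative.toAdd (κ (res (l₀ ^ n))) = (n : ℤ_[p])
      have hgen : κ d₀ = Multiplicative.ofAdd 1 := hd₀
      rw [map_zpow, map_zpow, hl₀', hgen, toAdd_zpow, toAdd_ofAdd, zsmul_one]
    have huniv : f '' (Z : Set (absoluteGaloisGroup F)) = Set.univ := by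
      have h := (PadicInt.denseRange_intCast.mono hsub).closure_eq
      rwa [hC.closure_eq] at h
    obtain ⟨z, hzZ, hz⟩ : f l ∈ f '' (Z : Set (absoluteGaloisGroup F)) := by
      rw [huniv]; trivial
    have hκ : κ (res z) = κ (res l) := Multiplicative.toAdd.injective hz
    have hmem : res (z⁻¹ * l) ∈ κ.kerSubgroup := by
      rw [ZpExtension.mem_kerSubgroup, map_mul, map_inv, map_mul, map_inv, hκ, inv_mul_cancel]
    have h := Z.mul_mem hzZ (hZker _ hmem)
    rwa [mul_inv_cancel_left] at h
  -- Step 5: `loc_v [S^bΦ₁] = 0` (x11b local-triviality bridge)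
  change (ContinuousCohomology.map (absGaloisRestrict K (v.adicCompletion K)) (X := (κ.twistModPk ρ hM L).toTopRep)
    (Y := DiscreteGaloisModule.toTopRep (ContinuousRep.restrict (κ.twistModPk ρ hM L) (absGaloisRestrict K (v.adicCompletion K))))
    (TopRep.ofHom ⟨ContinuousLinearMap.id ℤ (Fin L → M), fun _ => rfl⟩) 1).hom (oneCocycleClass _ φ) = 0
  exact (LocBridge.map_oneCocycleClass_eq_zero_iff (κ.twistModPk ρ hM L).toTopRep _ (absGaloisRestrict K (v.adicCompletion K))
    (TopRep.ofHom ⟨ContinuousLinearMap.id ℤ (Fin L → M), fun _ => rfl⟩) Function.bijective_id φ).2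
    ⟨a', fun l => (hmemZ l).1 (hZtop l)⟩

end Local

/-! ## §3 The elliptic spelling: `W.modPkTwist p k κ.invTwist L`, `κ⁻¹ = κ.invTwist` -/

section Curve

open Literature.NumberTheory.EllipticCurves.GreenbergSelmer (decomp)
open _root_.WeierstrassCurve

variable {K : Type} [Field K] [NumberField K] (W : WeierstrassCurve K) [W.IsElliptic]
  (p : ℕ) [hp : Fact p.Prime] (k : ℕ) (κ : ZpExtension K p) (L : ℕ) (v : HeightOneSpectrum (𝓞 K))

/-- **The engine for the dual level-`p^k` twist `𝒯^{(k)}_L(E, κ⁻¹) = W.modPkTwist p k κ.invTwist L`** (the carrier of the v4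
test class `Ψ`, `k = d + 1`): if `decomp v` contains a topological generator `d₀` of `κ⁻¹`, `p^b ≥ #{P ∈ E[p^k] : (decomp v ⊓ ker κ⁻¹) fixes P}`,
and a cocycle `Φ` of `Ψ` is principal on `decomp v ⊓ ker κ⁻¹`, then `loc_v ((κ⁻¹.shiftH1Pk E[p^k] _ L)^[b] Ψ) = 0` — for every
`L`, the same `b` (`ker κ⁻¹ = ker κ`, `ZpExtension.kerSubgroup_unitTwist`).  The stub's `twistModPkShiftEmbed ∘ twistModPkTruncate`
spelling follows by `…LocalExponentPkUniform.map_twistModPkShiftEmbed_map_twistModPkTruncate_eq_shiftH1Pk_iterate`.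
[cite: SerreGaloisCohomology1997, I §2.2–2.5, §5.1] [cite: GreenbergLNM1716, §3] -/
theorem localization_shiftH1Pk_iterate_modPkTwist_invTwist_eq_zero_of_principal
    {d₀ : absoluteGaloisGroup K} (hd₀D : d₀ ∈ decomp v) (hd₀ : κ.invTwist.IsTopGenerator d₀) {b : ℕ}
    (hN₀ : Nat.card {P : geomTorsion W ((p : ℤ) ^ k) //
      ∀ u ∈ decomp v ⊓ κ.invTwist.kerSubgroup, W.torsionGaloisModule ((p : ℤ) ^ k) u P = P} ≤ p ^ b)
    (Φ : contOneCocycles (W.modPkTwist p k κ.invTwist L).toTopRep)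
    (hΦ : ∃ x : Fin L → geomTorsion W ((p : ℤ) ^ k), ∀ u ∈ decomp v ⊓ κ.invTwist.kerSubgroup,
      Φ.1 u = W.modPkTwist p k κ.invTwist L u x - x) :
    galoisCohomology.localization (W.modPkTwist p k κ.invTwist L) (Sum.inr v) 1
      ((κ.invTwist.shiftH1Pk (W.torsionGaloisModule ((p : ℤ) ^ k)) (W.pow_nsmul_geomTorsion_eq_zero p k) L)^[b]
        (oneCocycleClass _ Φ)) = 0 := by
  haveI : Finite (geomTorsion W ((p : ℤ) ^ k)) :=
    finite_torsionPoints_holds W (AlgebraicClosure K) (pow_ne_zero _ (by exact_mod_cast hp.out.ne_zero))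
  exact localization_shiftH1Pk_iterate_eq_zero_of_principal_on_decomp_inf_ker
    (W.torsionGaloisModule ((p : ℤ) ^ k)) (W.pow_nsmul_geomTorsion_eq_zero p k) κ.invTwist L v hd₀D hd₀ hN₀ Φ hΦ

end Curve

end Summit.BirchSwinnertonDyer.BirchSwinnertonDyer.Theorems.OneSidedTwistSqueezeX9KatoDivisibilityX9LocalPEnginePk

end
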